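import Mathlib.Tactic
import HarnessLib

/-!
# The top-END climbs of the design `t3_080 h+w₁` all leave a `q`-atom

Kernel certificate for leg (iii) of THEOREM (A) of `widen/W1/TOPEND-w1cx1.md` (cell `pub-hsemireg`, W1,
seat w1-cx-1 gen 12).  The design's 99 letters ("atoms") are triples over the slot alphabet
{−𝒫₁, 𝒫₂, −𝒫₂, H, −H, q} with a parity ("shift"); at the top END cell the 50 shift-0 atoms sit at level −1
and the 49 shift-1 atoms at level 0.  A degree-0 CLIMB from `A` to `B` requires, slot by slot, `B_s = A_s` or
`h⁰(B_s − A_s) > 0`; on this alphabet the effective differences are exactly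
`−H → H, 𝒫₂, −𝒫₂, q, −𝒫₁`, `−𝒫₁ → H`, `q → H`, `𝒫₂ → H`, `−𝒫₂ → H` (engine-checked `h⁰` table, TOPEND §1).
We certify by `decide` that every climb from a shift-0 atom to a shift-1 atom starts at an atom whose
third slot is `q` — i.e. every return to level 0 at the top END passes through the climb `q → H` in slot 3
(the section `1 ∈ H⁰(𝒪(p))`, which vanishes along `p`), and that there are exactly 9 such climbs from exactly
the five atoms `(−H,−H,q), (−H,±𝒫₂,q), (±𝒫₂,−H,q)`.

Honest framing: a finite combinatorial certificate about one design's letter table (data transcribed from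
`t3_080_hpw.json`, sha256∕16 39561ce84ed654f6); nothing here bears on HC / HC_CM / HC_AV.
-/

namespace Summit.Ventures.HSemireg.TopEndClimbs

set_option maxRecDepth 20000

/-- The slot alphabet of the design `t3_080 h+w₁`. -/
inductive L | mP1 | P2 | mP2 | H | mH | q
  deriving DecidableEq, Repr

open L

/-- `up a b` : the letter difference `b − a` is a nonzero effective class with `h⁰ > 0` (degree-0 climb). -/
def up : L → L → Bool
  | mH, H => true | mH, P2 => true | mH, mP2 => true | mH, q => true | mH, mP1 => true
  | mP1, H => true | q, H => true | P2, H => true | mP2, H => true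
  | _, _ => false

/-- A degree-0 climb between two atoms: not equal, and every slot stays or climbs. -/
def climb (A B : L × L × L) : Bool :=
  (A != B) && (A.1 == B.1 || up A.1 B.1) && (A.2.1 == B.2.1 || up A.2.1 B.2.1) && (A.2.2 == B.2.2 || up A.2.2 B.2.2)

/-- The 50 shift-0 atoms (level −1 at the top END). -/
def shift0 : List (L × L × L) := [(.P2, .P2, .q), (.P2, .P2, .mP2), (.P2, .P2, .H), (.P2, .mP1, .mP1), (.P2, .mP2, .q), (.P2, .mP2, .P2), (.P2, .mP2, .H), (.P2, .H, .q), (.P2, .H, .P2), (.P2, .H, .mP2), (.P2, .H, .H), (.P2, .mH, .q), (.mP1, .P2, .mP1), (.mP1, .mP1, .P2), (.mP1, .mP1, .mP2), (.mP1, .mP2, .mP1), (.mP1, .mP2, .mP2), (.mP2, .P2, .q), (.mP2, .P2, .P2), (.mP2, .P2, .H), (.mP2, .mP1, .mP1), (.mP2, .mP1, .mP2), (.mP2, .mP2, .q), (.mP2, .mP2, .mP1), (.mP2, .mP2, .H), (.mP2, .H, .q), (.mP2, .H, .P2), (.mP2, .H, .mP2), (.mP2, .H, .H), (.mP2, .mH,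 .q), (.H, .P2, .q), (.H, .P2, .P2), (.H, .P2, .mP2), (.H, .P2, .H), (.H, .mP2, .q), (.H, .mP2, .P2), (.H, .mP2, .mP2), (.H, .mP2, .H), (.H, .H, .q), (.H, .H, .P2), (.H, .H, .mP2), (.H, .H, .H), (.H, .H, .mH), (.H, .mH, .q), (.H, .mH, .H), (.mH, .P2, .q), (.mH, .mP2, .q), (.mH, .H, .q), (.mH, .H, .H), (.mH, .mH, .q)]

/-- The 49 shift-1 atoms (levels 0 and −2 at the top END). -/
def shift1 : List (L × L × L) := [(.P2, .P2, .P2), (.P2, .P2, .mP1), (.P2, .P2, .mH), (.P2, .mP1, .P2), (.P2, .mP1, .mP2), (.P2, .mP2, .mP1), (.P2, .mP2, .mP2), (.P2, .mP2, .mH), (.P2, .H, .mH), (.P2, .mH, .P2), (.P2, .mH, .mP2), (.P2, .mH, .H), (.P2, .mH, .mH), (.mP1, .P2, .P2), (.mP1, .P2, .mP2), (.mP1, .mP1, .mP1), (.mP1, .mP2, .P2), (.mP2, .P2, .mP1), (.mP2, .P2, .mP2), (.mP2, .P2, .mH), (.mP2, .mP1, .P2), (.mP2, .mP2, .P2), (.mP2,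 .mP2, .mP2), (.mP2, .mP2, .mH), (.mP2, .H, .mH), (.mP2, .mH, .P2), (.mP2, .mH, .mP2), (.mP2, .mH, .H), (.mP2, .mH, .mH), (.H, .P2, .mH), (.H, .mP2, .mH), (.H, .mH, .P2), (.H, .mH, .mP2), (.H, .mH, .mH), (.mH, .P2, .P2), (.mH, .P2, .mP2), (.mH, .P2, .H), (.mH, .P2, .mH), (.mH, .mP2, .P2), (.mH, .mP2, .mP2), (.mH, .mP2, .H), (.mH, .mP2, .mH), (.mH, .H, .P2), (.mH, .H, .mP2), (.mH, .H, .mH), (.mH, .mH, .P2), (.mH, .mH, .mP2), (.mH, .mH, .H), (.mH, .mH, .mH)]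

/-- The atom table has the advertised sizes. -/
theorem sizes : shift0.length = 50 ∧ shift1.length = 49 := by decide

/-- Every degree-0 climb from a level −1 atom to a level 0 atom starts at an atom with `q` in slot 3. -/
theorem climb_source_is_q :
    (shift0.all fun A => shift1.all fun B => (!climb A B) || (A.2.2 == q)) = true := by decide

/-- There are exactly 9 such climbs … -/
theorem nine_climbs :
    ((shift0.product shift1).filter fun AB => climb AB.1 AB.2).length = 9 := by decide

/-- … and their sources are exactly the five atoms `(−H,−H,q), (−H,𝒫₂,q), (−H,−𝒫₂,q), (𝒫₂,−H,q), (−𝒫₂,−H,q)`. -/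
theorem climb_sources :
    ((shift0.product shift1).filter fun AB => climb AB.1 AB.2).map (·.1)
      = [(P2, mH, q), (mP2, mH, q), (mH, P2, q), (mH, mP2, q), (mH, mH, q), (mH, mH, q), (mH, mH, q), (mH, mH, q), (mH, mH, q)] := by decide

end Summit.Ventures.HSemireg.TopEndClimbs
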